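import Summits.CriticalPhenomena.PercolationContinuityZ3.Theorems.PercNearOneGluingNoHeavyLowerTailSunflowerPhiZero

/-!
# CONJECTURE Φ₀ is FALSE: an explicit five-petal counterexample

`Phi0Conj` (prove-1 gen 54, `…SunflowerPhiZero`) asserted the budget-FREE bound `∏ G_j ≤ g^(n−1)·(gΦ₀)` for every
family of petals.  It holds for `n = 2` (`phi0_pair_model`) and on the class `h ≤ k` (`res0_classK`), but it is false in
general: at `τ = σ = 1/500`, `s = 1/2`, `α₀₀ = α₀₁ = 10⁻⁶`, `α₁₁ = 10⁻³`, `c₀ = τσ + (1−s)(1−τ)α₀₀`, the family of two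
Ȳ-petals `(y,k,g,h) = (1,1,α₀₁,α₁₁)` and three `h`-petals `(α₀₀,α₀₁,α₀₁,1)` has `∏ G_j / (g⁴·gΦ₀) ≈ 6.24`.
Mechanism (prove-1 gen 55 memo): the cross term (Ȳ-cloud value) × (h-cloud value) is multiplicative in the two clouds,
while every potential that is additive in the coin usages `X, K, R, Y` (Φ₀ ≤ Φ*′ ≤ Φ*) pays it from ONE cloud's credit;
the family is budget-infeasible (`X = K = 10¹² ≫ X_f`, `R = 10⁹ ≫ Ĥ`), so (RES0′) itself is not touched — the budgets
are essential for `n ≥ 5`, and `res0_of_phi0Conj` is vacuous. [this work]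
-/

namespace Summit.CriticalPhenomena.PercolationContinuityZ3.Theorems.SunflowerPartition.SafeCalc.LinkedCurrency

/-- **`Phi0Conj` is false** (explicit counterexample with `n = 5`: two Ȳ-petals and three `h`-petals at
`τ = σ = 1/500, s = 1/2, α₀₀ = α₀₁ = 10⁻⁶, α₁₁ = 10⁻³`; ratio `≈ 6.24`). [this work] -/
theorem not_phi0Conj : ¬ Phi0Conj := by
  intro hΦ
  have h := hΦ 5 (1/500) (1/500) (1/2) (1/10^6) (1/10^6) (1/1000) (4499/1000000000)
    ![1, 1, 1/10^6, 1/10^6, 1/10^6] ![1, 1, 1/10^6, 1/10^6, 1/10^6]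
    ![1/10^6, 1/10^6, 1/10^6, 1/10^6, 1/10^6] ![1/1000, 1/1000, 1, 1, 1]
    (by norm_num) (by norm_num) (by norm_num) (by norm_num) (by norm_num) (by norm_num) (by norm_num)
    (by norm_num) (by norm_num) (by norm_num) (by norm_num) (by norm_num) (by norm_num)
    (fun j => by fin_cases j <;> simp <;> norm_num) (fun j => by fin_cases j <;> simp)
    (fun j => by fin_cases j <;> simp <;> norm_num) (fun j => by fin_cases j <;> simp)
    (fun j => by fin_cases j <;> simp <;> norm_num) (fun j => by fin_cases j <;> simp <;> norm_num)
    (fun j => by fin_cases j <;> simp <;> norm_num) (fun j => by fin_cases j <;> simp <;> norm_num)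
  simp only [phi0Num, Fin.prod_univ_five, Matrix.cons_val_zero, Matrix.cons_val_one, Matrix.head_cons,
    Matrix.cons_val_two, Matrix.cons_val_three, Matrix.cons_val_four, Matrix.tail_cons] at h
  norm_num [max_def] at h

end Summit.CriticalPhenomena.PercolationContinuityZ3.Theorems.SunflowerPartition.SafeCalc.LinkedCurrency
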